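import Literature.Topology.FourManifolds.SmoothOrientation
import Mathlib.Topology.Instances.Matrix
import HarnessLib

/-!
# A continuous frame along a loop in an oriented manifold returns with positive determinant

Topic `Literature/Topology/FourManifolds` (companion of `SmoothOrientation.lean`).  The
elementary half of "a manifold is orientable iff the orientation character of every loop is
trivial" (Hirsch, *Differential Topology* (1976), §4.4; Lee, *Introduction to Smooth Manifolds*
(2013), Ch. 15, pp. 380–383, "an orientation of `M` determines an orientation of `T_pM` …
continuously"): on a manifold `M` carrying a `SmoothOrientation` (`o : SmoothOrientation I M`),
let `t ↦ (f₁(t), …, f_n(t))` be a CONTINUOUS FRAME of `TM` along a continuous path `γ : ℝ → M`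
(each `fᵢ` a continuous section of `TM` over `γ`, the `fᵢ(t)` a basis of `T_{γ t}M`).  Then

* `eventually_map_tangentCoordChange_orientation_eq` — near `x₀`, transporting `o y` to the chart
  at `x₀` by the tangent coordinate change gives `o x₀` (the defining property of a smooth
  orientation, both when `o y = o x₀` and when `o y = -o x₀`);
* `frameOrientation_iff_eventually` — the predicate "`(fᵢ(t))ᵢ` is positively oriented for
  `o (γ t)`" is LOCALLY CONSTANT in `t` (read the frame in the trivialisation of `TM` at
  `γ t₀`: a continuous family of bases of the fixed space `E`, whose orientation is locally
  constant, `Basis.orientation_eq_iff_det_pos`);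
* `det_pos_of_frame_along_loop` — **if `γ T = γ 0` and the frame returns transformed by a
  linear map `L` of `T_{γ 0}M`, `fᵢ(T) = L fᵢ(0)`, then `det L > 0`** (local constancy on the
  connected parameter line): the restriction of `TM` to a loop in an orientable manifold is an
  orientable bundle, i.e. frames have orientation-preserving holonomy.

Used for tubular neighbourhoods of embedded circles with `2π`-PERIODIC normal frames
(`Literature/Geometry/Symplectic`, zero circles of near-symplectic forms on a punctured homotopy
sphere).  Everything is proved; no definitions, no named facts.

## References

* M. W. Hirsch, *Differential Topology*, GTM 33 (1976), §4.4. [HirschDT1976]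
* J. M. Lee, *Introduction to Smooth Manifolds*, 2nd ed., GTM 218 (2013), Ch. 15, pp. 380–383.
  [LeeSmoothManifolds2013]
-/

noncomputable section

open Bundle Set Filter Module Function
open scoped Manifold Topology

namespace Literature.Topology.FourManifolds

variable {E H : Type*} [NormedAddCommGroup E] [NormedSpace ℝ E] [FiniteDimensional ℝ E]
  [TopologicalSpace H] {I : ModelWithCorners ℝ E H}
  {M : Type*} [TopologicalSpace M] [ChartedSpace H M] [IsManifold I 1 M]

/-! ### The tangent coordinate change as a linear equivalence -/

omit [FiniteDimensional ℝ E] in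
/-- For `y` in the chart domain of `x₀`, the tangent coordinate change `y → x₀` at `y` is a linear
equivalence of the model space (inverse: the change `x₀ → y`). [folklore] -/
theorem exists_linearEquiv_tangentCoordChange {y x₀ : M} (hy : y ∈ (extChartAt I x₀).source) :
    ∃ L : E ≃ₗ[ℝ] E, (L : E →ₗ[ℝ] E) = ((tangentCoordChange I y x₀ y : E →L[ℝ] E) : E →ₗ[ℝ] E) := by
  have hyy : y ∈ (extChartAt I y).source := mem_extChartAt_source y
  refine ⟨LinearEquiv.ofLinear ((tangentCoordChange I y x₀ y : E →L[ℝ] E) : E →ₗ[ℝ] E)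
    ((tangentCoordChange I x₀ y y : E →L[ℝ] E) : E →ₗ[ℝ] E) ?_ ?_, rfl⟩
  · ext v
    simp only [LinearMap.coe_comp, ContinuousLinearMap.coe_coe, comp_apply, LinearMap.id_coe,
      id_eq]
    rw [tangentCoordChange_comp ⟨⟨hy, hyy⟩, hy⟩, tangentCoordChange_self hy]
  · ext v
    simp only [LinearMap.coe_comp, ContinuousLinearMap.coe_coe, comp_apply, LinearMap.id_coe,
      id_eq]
    rw [tangentCoordChange_comp ⟨⟨hyy, hy⟩, hyy⟩, tangentCoordChange_self hyy]

/-- **Transport of a smooth orientation by the tangent coordinate change**: near `x₀`, the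
orientation `o y` carried to the chart at `x₀` by `tangentCoordChange I y x₀ y` is `o x₀`
(defining property of `SmoothOrientation`: `o y = o x₀` iff the change has positive determinant;
otherwise `o y = -o x₀` and the change has negative determinant). [cite: HirschDT1976, §4.4] -/
theorem eventually_map_tangentCoordChange_orientation_eq (o : SmoothOrientation I M) (x₀ : M) :
    ∀ᶠ y in 𝓝 x₀, ∀ L : E ≃ₗ[ℝ] E,
      (L : E →ₗ[ℝ] E) = ((tangentCoordChange I y x₀ y : E →L[ℝ] E) : E →ₗ[ℝ] E) →
        Orientation.map (Fin (finrank ℝ E)) L (o y) = o x₀ := by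
  have hcard : Fintype.card (Fin (finrank ℝ E)) = finrank ℝ E := Fintype.card_fin _
  filter_upwards [o.eventually_eq_iff x₀] with y hy L hL
  have hdetL : LinearMap.det (L : E →ₗ[ℝ] E) =
      LinearMap.det ((tangentCoordChange I y x₀ y : E →L[ℝ] E) : E →ₗ[ℝ] E) := by rw [hL]
  have hdet0 : LinearMap.det (L : E →ₗ[ℝ] E) ≠ 0 := (LinearEquiv.isUnit_det' L).ne_zero
  by_cases h : o y = o x₀
  · rw [h]
    exact (Orientation.map_eq_iff_det_pos (o x₀) L hcard).2 (hdetL ▸ hy.1 h)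
  · have hneg : o y = -o x₀ := (Orientation.eq_or_eq_neg (o y) (o x₀) hcard).resolve_left h
    have hlt : LinearMap.det (L : E →ₗ[ℝ] E) < 0 := by
      rcases lt_trichotomy (LinearMap.det (L : E →ₗ[ℝ] E)) 0 with h1 | h1 | h1
      · exact h1
      · exact absurd h1 hdet0
      · exact absurd (hy.2 (hdetL ▸ h1)) h
    rw [hneg, Orientation.map_neg, (Orientation.map_eq_neg_iff_det_neg (o x₀) L hcard).2 hlt]
    exact neg_neg (o x₀)

/-! ### Frames along a path: the orientation sign is locally constant -/

section Frame

variable {γ : ℝ → M} {f : ℝ → Fin (finrank ℝ E) → E}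

omit [FiniteDimensional ℝ E] in
/-- The basis of the model space given by a frame (frames are read in the preferred charts,
`T_xM = E`). [folklore] -/
theorem exists_basis_of_frame (hn : 0 < finrank ℝ E) (hli : ∀ t, LinearIndependent ℝ (f t))
    (t : ℝ) : ∃ B : Basis (Fin (finrank ℝ E)) ℝ E, ⇑B = f t := by
  haveI : Nonempty (Fin (finrank ℝ E)) := ⟨⟨0, hn⟩⟩
  exact ⟨_, coe_basisOfLinearIndependentOfCardEqFinrank (hli t) (Fintype.card_fin _)⟩

/-- **Local constancy of the orientation sign of a continuous frame** (Lee 2013, Ch. 15,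
continuity of pointwise orientations): if each `fᵢ` is a continuous section of `TM` along `γ` and
the `fᵢ(t)` form a basis `B_t` of `T_{γ t}M`, then near every `t₀` the truth value of
"`B_t` is positively oriented for `o (γ t)`" is that at `t₀`. [cite: LeeSmoothManifolds2013, Ch. 15] -/
theorem frameOrientation_iff_eventually (o : SmoothOrientation I M) (hn : 0 < finrank ℝ E)
    (hf : ∀ i, Continuous fun t ↦ (TotalSpace.mk' E (γ t) (f t i) : TangentBundle I M))
    (B : ℝ → Basis (Fin (finrank ℝ E)) ℝ E) (hB : ∀ t, ⇑(B t) = f t) (t₀ : ℝ) :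
    ∀ᶠ t in 𝓝 t₀, ((B t).orientation = o (γ t) ↔ (B t₀).orientation = o (γ t₀)) := by
  classical
  set x₀ := γ t₀ with hx₀
  have hcard : Fintype.card (Fin (finrank ℝ E)) = finrank ℝ E := Fintype.card_fin _
  -- continuity of `γ` (projection of a continuous section)
  haveI hne : Nonempty (Fin (finrank ℝ E)) := ⟨⟨0, hn⟩⟩
  obtain ⟨i₀⟩ := hne
  have hγc : Continuous γ := by
    have := (FiberBundle.continuous_proj E (TangentSpace I : M → Type _)).comp (hf i₀)
    exact this
  -- points near `t₀` map into the chart domain of `x₀`, where the orientation transports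
  have hsrc : ∀ᶠ t in 𝓝 t₀, γ t ∈ (extChartAt I x₀).source :=
    hγc.continuousAt.preimage_mem_nhds (extChartAt_source_mem_nhds (I := I) x₀)
  have hor : ∀ᶠ t in 𝓝 t₀, ∀ L : E ≃ₗ[ℝ] E,
      (L : E →ₗ[ℝ] E) = ((tangentCoordChange I (γ t) x₀ (γ t) : E →L[ℝ] E) : E →ₗ[ℝ] E) →
        Orientation.map (Fin (finrank ℝ E)) L (o (γ t)) = o x₀ :=
    hγc.continuousAt.eventually (eventually_map_tangentCoordChange_orientation_eq o x₀)
  -- the frame read in the trivialisation at `x₀`: `f̃ t i = tangentCoordChange (γ t) x₀ (γ t) (f t i)`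
  set Φ := trivializationAt E (TangentSpace I : M → Type _) x₀ with hΦ
  set g : ℝ → Fin (finrank ℝ E) → E := fun t i ↦ (Φ ⟨γ t, f t i⟩).2 with hg
  have hg_eq : ∀ t i, g t i = tangentCoordChange I (γ t) x₀ (γ t) (f t i) := fun t i ↦ rfl
  have hgc : ∀ i, ContinuousAt (fun t ↦ g t i) t₀ := by
    intro i
    have hmem : (TotalSpace.mk' E (γ t₀) (f t₀ i) : TangentBundle I M) ∈ Φ.source := by
      rw [hΦ, TangentBundle.trivializationAt_source]
      exact mem_chart_source H x₀
    have h1 : ContinuousAt Φ (TotalSpace.mk' E (γ t₀) (f t₀ i)) :=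
      Φ.continuousOn.continuousAt (Φ.open_source.mem_nhds hmem)
    exact (ContinuousAt.comp (f := fun t ↦ (TotalSpace.mk' E (γ t) (f t i) : TangentBundle I M))
      (x := t₀) h1 (hf i).continuousAt).snd
  -- the determinant of `g t` in the basis `g t₀` is continuous and equals `1` at `t₀`
  obtain ⟨L₀, hL₀⟩ := exists_linearEquiv_tangentCoordChange (I := I) (mem_extChartAt_source x₀ :
    x₀ ∈ (extChartAt I x₀).source)
  set B₀ : Basis (Fin (finrank ℝ E)) ℝ E := (B t₀).map L₀ with hB₀
  have hB₀g : ⇑B₀ = g t₀ := by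
    funext i
    rw [hB₀, Basis.map_apply, hB t₀, hg_eq, ← LinearEquiv.coe_coe, hL₀]
    rfl
  have hdetc : ContinuousAt (fun t ↦ B₀.det (g t)) t₀ := by
    have hm : ContinuousAt (fun t ↦ B₀.toMatrix (g t)) t₀ := by
      refine continuousAt_pi.2 fun i ↦ continuousAt_pi.2 fun j ↦ ?_
      simp only [Basis.toMatrix_apply]
      exact ((B₀.coord i).continuous_of_finiteDimensional.continuousAt).comp (hgc j)
    simp only [Basis.det_apply]
    have hdc : Continuous fun A : Matrix (Fin (finrank ℝ E)) (Fin (finrank ℝ E)) ℝ ↦ A.det :=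
      continuous_id.matrix_det
    exact ContinuousAt.comp (f := fun t ↦ B₀.toMatrix (g t)) (x := t₀) hdc.continuousAt hm
  have hdet1 : B₀.det (g t₀) = 1 := by rw [← hB₀g]; exact B₀.det_self
  have hdetpos : ∀ᶠ t in 𝓝 t₀, 0 < B₀.det (g t) := by
    have : ∀ᶠ s in 𝓝 (B₀.det (g t₀)), 0 < s := by
      rw [hdet1]; exact eventually_gt_nhds zero_lt_one
    exact hdetc.eventually this
  -- assemble
  filter_upwards [hsrc, hor, hdetpos] with t ht hto hdt
  obtain ⟨L, hL⟩ := exists_linearEquiv_tangentCoordChange (I := I) ht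
  -- the transported basis `(B t).map L` has vectors `g t`
  have hBL : ⇑((B t).map L) = g t := by
    funext i
    rw [Basis.map_apply, hB t, hg_eq, ← LinearEquiv.coe_coe, hL]
    rfl
  -- orientation of `(B t).map L` equals that of `B₀` (positive determinant)
  have hBL₀ : ((B t).map L).orientation = B₀.orientation := by
    rw [Basis.orientation_eq_iff_det_pos]
    -- `((B t).map L).det B₀ > 0` iff `B₀.det ((B t).map L) > 0`
    have h1 : 0 < B₀.det ⇑((B t).map L) := by rw [hBL]; exact hdt
    have h2 := ((B t).map L).det.eq_smul_basis_det B₀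
    have h3 : ((B t).map L).det B₀ * B₀.det ((B t).map L) = 1 := by
      have := congrArg (fun (φ : E [⋀^Fin (finrank ℝ E)]→ₗ[ℝ] ℝ) ↦ φ ((B t).map L)) h2
      simp only [AlternatingMap.smul_apply, smul_eq_mul, Basis.det_self] at this
      linarith [this]
    nlinarith [h1, h3, sq_nonneg (((B t).map L).det B₀)]
  -- the same at `t₀`: `(B t₀).map L₀ = B₀`
  constructor
  · intro h
    -- `map L (B t).or = map L (o (γ t)) = o x₀`, i.e. `B₀.or = o x₀`; then back at `t₀`.
    have h1 : B₀.orientation = o x₀ := by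
      rw [← hBL₀, Basis.orientation_map, h, hto L hL]
    have h2 : Orientation.map (Fin (finrank ℝ E)) L₀ ((B t₀).orientation) = o x₀ := by
      rw [← Basis.orientation_map, ← hB₀]; exact h1
    have h3 : Orientation.map (Fin (finrank ℝ E)) L₀ (o (γ t₀)) = o x₀ :=
      hor.self_of_nhds L₀ hL₀
    exact (Orientation.map (Fin (finrank ℝ E)) L₀).injective (h2.trans h3.symm)
  · intro h
    have h3 : Orientation.map (Fin (finrank ℝ E)) L₀ (o (γ t₀)) = o x₀ :=
      hor.self_of_nhds L₀ hL₀
    have h1 : B₀.orientation = o x₀ := by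
      rw [hB₀, Basis.orientation_map, h, h3]
    have h2 : Orientation.map (Fin (finrank ℝ E)) L ((B t).orientation) = o x₀ := by
      rw [← Basis.orientation_map, hBL₀]; exact h1
    exact (Orientation.map (Fin (finrank ℝ E)) L).injective (h2.trans (hto L hL).symm)

/-- **The holonomy of a continuous frame along a loop in an oriented manifold has positive
determinant** (Hirsch 1976, §4.4; Lee 2013, Ch. 15): if `γ T = γ 0` and the frame returns as
`fᵢ(T) = L fᵢ(0)` for a linear map `L` of the model space (`T_{γ 0}M` read in its chart), then
`0 < det L`. [cite: HirschDT1976, §4.4] -/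
theorem det_pos_of_frame_along_loop (o : SmoothOrientation I M) (hn : 0 < finrank ℝ E)
    (hf : ∀ i, Continuous fun t ↦ (TotalSpace.mk' E (γ t) (f t i) : TangentBundle I M))
    (hli : ∀ t, LinearIndependent ℝ (f t)) {T : ℝ} (hT : γ T = γ 0) {L : E →ₗ[ℝ] E}
    (hL : ∀ i, f T i = L (f 0 i)) : 0 < LinearMap.det L := by
  classical
  choose B hB using exists_basis_of_frame hn hli
  -- the orientation sign is locally constant, hence constant on `ℝ`
  set A : Set ℝ := {t | (B t).orientation = o (γ t)} with hA
  have hloc : ∀ t₀, ∀ᶠ t in 𝓝 t₀, (t ∈ A ↔ t₀ ∈ A) := fun t₀ ↦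
    frameOrientation_iff_eventually o hn hf B hB t₀
  have hopen : IsOpen A := isOpen_iff_mem_nhds.2 fun t₀ ht₀ ↦
    (hloc t₀).mono fun t ht ↦ ht.2 ht₀
  have hclosed : IsOpen Aᶜ := isOpen_iff_mem_nhds.2 fun t₀ ht₀ ↦
    (hloc t₀).mono fun t ht h ↦ ht₀ (ht.1 h)
  have hclopen : IsClopen A := ⟨⟨hclosed⟩, hopen⟩
  have hiff : (0 : ℝ) ∈ A ↔ T ∈ A := by
    rcases isClopen_iff.1 hclopen with h | h
    · simp [h]
    · simp [h]
  -- `L` as a linear equivalence mapping the basis `B 0` to the basis `B T`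
  set L' : E ≃ₗ[ℝ] E := (B 0).equiv (B T) (Equiv.refl _) with hL'
  have hL'L : (L' : E →ₗ[ℝ] E) = L := by
    refine (B 0).ext fun i ↦ ?_
    rw [LinearEquiv.coe_coe, hL', Basis.equiv_apply, Equiv.refl_apply, hB T, hL i, hB 0]
  have hmap : (B 0).map L' = B T :=
    Basis.eq_of_apply_eq fun i ↦ by rw [Basis.map_apply, hL', Basis.equiv_apply, Equiv.refl_apply]
  rw [← hL'L, ← Basis.orientation_comp_linearEquiv_eq_iff_det_pos (B 0) L', hmap]
  -- compare the two signs at the common point `γ 0 = γ T`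
  simp only [hA, mem_setOf_eq, hT] at hiff
  by_cases h0 : (B 0).orientation = o (γ 0)
  · rw [h0]; exact hiff.1 h0
  · have hT' : (B T).orientation ≠ o (γ 0) := fun h ↦ h0 (hiff.2 h)
    rcases (B 0).orientation_eq_or_eq_neg ((B T).orientation) with h1 | h1
    · exact h1
    · exfalso
      rcases (B 0).orientation_eq_or_eq_neg (o (γ 0)) with h2 | h2
      · exact h0 h2.symm
      · exact hT' (h1.trans h2.symm)

end Frame

end Literature.Topology.FourManifolds

end
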